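import Summits.BirchSwinnertonDyer.BirchSwinnertonDyer.Theorems.GenusKolyvaginAtTwoShaCardDvdPowAtTwoROneBitDescent
import Summits.BirchSwinnertonDyer.BirchSwinnertonDyer.Theorems.GenusKolyvaginAtTwoVisiblePairAtTwoVisibility
import HarnessLib

/-!
# Route `GenusKolyvaginAtTwo`, crux U_T `ShaCardDvdPowAtTwoRT` (stmt-BirchSwinnertonDyer-23658; upper half
# `#Ш(E/K)[2^∞] ∣ 2^(2M₀)`) — LEVEL-FORM ONE-BIT DESCENT: dropping ONE LEVEL pays the bit of the quadratic descent of the Selmer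
# condition — a class over `F` whose level-`n` «double» is Selmer over a quadratic `L` is Selmer over `F` at the LOWER level `d`

Seat `bsd-line-gk2-p3` g25 (PROVER seat 3/3, cell `bsd-f1-sign2`), `--supports stmt-BirchSwinnertonDyer-23658` (helper; closes nothing).
THEOREMS ONLY (no definition, no named fact, no `sorry`), pure plumbing over this lineage's `…ShaCardDvdPowAtTwoROneBitDescent` (g14, p659455)
and `…VisiblePairAtTwoVisibility` (`torsionH1OfDvd_mem_selmerLocalKer_iff`).  BSD is NOT proved by any of this; neither is U_T nor any stub.

WHY (seat memo `Cruxes/ShaCardDvdPowAtTwoRT/Lines/norm-sharp-upper-gk2p3.md` §8, stub TQ-DEEP of the proposed hybrid line for U_T).  The ONLY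
place-type at which the quadratic descent `K → ℚ` of the Selmer condition loses a bit is a transposition prime `q ∣ d_K` (g14: DefectPrimes
p657853, OneBitDescent p659455: `res_w u Selmer ⟹ 2u Selmer`, and no better in general).  For Kolyvagin classes the bit is FREE one level
up: by McCallum's Lemma 4.6 (tree: `torsionH1OfDvd_kolyvaginClass_pow`, `…RTLevelCompatibility`) `ι_* c_M(n) = 2 • c_{M+1}(n)` whenever the
primes of `n` have index `≥ M + 1` (margin one, the LINE's (R2) currency), and `c_{M+1}(n)` is Selmer at `w ∣ q` over `K` (Gross 6.2, tree:
`kolyvaginClass_two_mem_selmerLocalKer_of_odd_tamagawaProduct`).  This file is the descent step in pure Selmer language, for ANY class: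
**if `ι_* u_d = 2 • u_n` (`ι : E[d] ↪ E[n]`, `d ∣ n`) and `res_L u_n` is Selmer at `w ∣ v` along `[L : F] ≤ 2`, then `u_d` is Selmer at `v`**
(OneBitDescent gives `2 u_n = ι_* u_d` Selmer at `v`, and `ι_*` reflects the Selmer local condition).  Applied to the ℚ-descents
`u_M, u_{M+1}` of `c_M(n), c_{M+1}(n)` (either sign: member `E` via `resTorsion`, twin member `E^{(d_K)}` via `hPsiKT`, this lineage's
`…EigenClassesFinite`): **the ℚ-descended margin-one Kolyvagin class is Selmer at every transposition prime** — the nuisance term of the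
memo's §4 vanishes (§8), with no Heegner-point geometry.
* §1 `mem_selmerLocalKer_of_torsionH1OfDvd_eq_two_zsmul` — general `[L : F] ≤ 2`, any finite place, any levels `d ∣ n`.
* §2 over `ℚ` with `K` quadratic: member `E` (`…_of_K`), twin member `E^{(c)}` (`…_twin_of_K`), and the global forms on `Δ(E) < 0`
  (`mem_selmerGroup_of_torsionH1OfDvd_eq_two_zsmul(_twin)`): **`ι_* u_d = 2 u_n`, `res u_n ∈ Sel^{(n)}(E_K/K) ⟹ u_d ∈ Sel^{(d)}(E/ℚ)`**.

References: [McCallumLMS1991] §4 Lemma 4.3, Lemma 4.6; [Kolyvagin1989Izv] §3; [SerreGaloisCohomology1997] I §2.4; [Kramer1981] Prop. 3;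
[MazurRubin2010] Lemma 2.2 (i).
-/

set_option autoImplicit false
set_option linter.dupNamespace false -- tree convention: `Summit.BirchSwinnertonDyer.BirchSwinnertonDyer.Theorems` (summit = sub-problem)

noncomputable section

open scoped Classical

universe u

namespace Summit.BirchSwinnertonDyer.BirchSwinnertonDyer.Theorems.GenusExact.SelmerDescent

open WeierstrassCurve NumberField IsDedekindDomain Field
open Literature.NumberTheory.EllipticCurves Literature.NumberTheory.GaloisRepresentations
open Summit.BirchSwinnertonDyer.BirchSwinnertonDyer.Theorems.GenusExact.ArchVanishing
open Summit.BirchSwinnertonDyer.BirchSwinnertonDyer.Theorems.GenusExact.VisiblePairAtTwo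

/-! ## §1 Degree `≤ 2`: one level down, no bit lost -/

section General

variable {F : Type u} [Field F] [NumberField F] (W : WeierstrassCurve F)
variable (L : Type u) [Field L] [NumberField L] [Algebra F L]
variable (v : HeightOneSpectrum (𝓞 F)) (w : HeightOneSpectrum (𝓞 L)) [w.asIdeal.LiesOver v.asIdeal]

/-- **LEVEL-FORM ONE-BIT DESCENT.**  `[L : F] ≤ 2`, `v` a finite place of `F`, `w ∣ v`, levels `d ∣ n` (any), `ι_* : H¹(F, E[d]) → H¹(F, E[n])`
(`torsionH1OfDvd`).  If `ι_* u_d = 2 • u_n` and `res_L u_n` satisfies the Selmer condition at `w`, then `u_d` satisfies the Selmer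
condition at `v`: `2 • u_n` is Selmer at `v` by the one-bit descent (`cor ∘ res = 2`), and `ι_*` reflects the Selmer local condition.
[cite: McCallumLMS1991, §4 Lemma 4.3 and Lemma 4.6] [cite: SerreGaloisCohomology1997, I §2.4 (Cor. to Prop. 9)] -/
theorem mem_selmerLocalKer_of_torsionH1OfDvd_eq_two_zsmul (h2 : Module.finrank F L ≤ 2) {d n : ℤ} (hdn : d ∣ n)
    {ud : galH1Torsion W d} {un : galH1Torsion W n} (hι : torsionH1OfDvd W hdn ud = (2 : ℤ) • un)
    (hx : resTorsion W L n un ∈ selmerLocalKer (W.baseChange L) (w.adicCompletion L) n) :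
    ud ∈ selmerLocalKer W (v.adicCompletion F) d := by
  have h := two_zsmul_mem_selmerLocalKer_of_resTorsion_mem W L v w h2 n hx
  rw [← hι] at h
  exact (torsionH1OfDvd_mem_selmerLocalKer_iff W (v.adicCompletion F) hdn ud).mpr h

end General

/-! ## §2 Over `ℚ` with `K` quadratic: both members, local and global -/

section Rat

variable {K : Type} [Field K] [NumberField K] (W : WeierstrassCurve ℚ)

/-- **Member `E`, one finite place, one level down**: `ι_* u_d = 2 • u_n`, `res u_n = c_K` Selmer at the places of `K` above `v` ⟹ `u_d` is
Selmer at `v` (any `v` — in particular a transposition prime `q ∣ d_K` —, any reduction, any `d ∣ n`).  For the LINE: `u_d, u_n` the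
ℚ-descents of `c_M(n), c_{M+1}(n)`, `ι_* c_M = 2 c_{M+1}` (Lemma 4.6, margin one). [cite: McCallumLMS1991, §4 Lemma 4.3 and Lemma 4.6]
[cite: Kolyvagin1989Izv, §3] -/
theorem mem_selmerLocalKer_of_torsionH1OfDvd_eq_two_zsmul_of_K (h2 : Module.finrank ℚ K = 2) {d n : ℤ} (hdn : d ∣ n)
    {ud : galH1Torsion W d} {un : galH1Torsion W n} (hι : torsionH1OfDvd W hdn ud = (2 : ℤ) • un)
    {cK : galH1Torsion (W.baseChange K) n} (hu : resTorsion W K n un = cK) (v : HeightOneSpectrum (𝓞 ℚ))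
    (hK : ∀ (w : HeightOneSpectrum (𝓞 K)) [w.asIdeal.LiesOver v.asIdeal],
      cK ∈ selmerLocalKer (W.baseChange K) (w.adicCompletion K) n) :
    ud ∈ selmerLocalKer W (v.adicCompletion ℚ) d := by
  have h := two_zsmul_mem_selmerLocalKer_of_K W h2 n hu v hK
  rw [← hι] at h
  exact (torsionH1OfDvd_mem_selmerLocalKer_iff W (v.adicCompletion ℚ) hdn ud).mpr h

/-- **Twin member `E^{(c)}`, one finite place, one level down** (`K = ℚ(θ)`, `θ² = c`): `ι_* y_d = 2 • y_n` in `H¹(ℚ, E^{(c)}[·])`,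
`hPsiKT (res y_n) = c_K` Selmer at the places of `K` above `v` ⟹ `y_d` is Selmer at `v` — the sign-`−` Kolyvagin classes descend to the
twin, which is ADDITIVE at the transposition primes; no bit is lost one level down all the same. [cite: McCallumLMS1991, §4 Lemma 4.3 and Lemma 4.6]
[cite: Kolyvagin1989Izv, §3] -/
theorem mem_selmerLocalKer_twin_of_torsionH1OfDvd_eq_two_zsmul_of_K (h2 : Module.finrank ℚ K = 2) {θ : K} {c : ℚ}
    (hθ : θ ∉ Set.range (algebraMap ℚ K)) (hc : θ ^ 2 = algebraMap ℚ K c) {d n : ℤ} (hdn : d ∣ n)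
    {yd : galH1Torsion (W.quadraticTwist c) d} {yn : galH1Torsion (W.quadraticTwist c) n}
    (hι : torsionH1OfDvd (W.quadraticTwist c) hdn yd = (2 : ℤ) • yn)
    {cK : galH1Torsion (W.baseChange K) n}
    (hy : hPsiKT W K hθ hc n (resTorsion (W.quadraticTwist c) K n yn) = cK) (v : HeightOneSpectrum (𝓞 ℚ))
    (hK : ∀ (w : HeightOneSpectrum (𝓞 K)) [w.asIdeal.LiesOver v.asIdeal],
      cK ∈ selmerLocalKer (W.baseChange K) (w.adicCompletion K) n) :
    yd ∈ selmerLocalKer (W.quadraticTwist c) (v.adicCompletion ℚ) d := by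
  have h := two_zsmul_mem_selmerLocalKer_twin_of_K W h2 hθ hc n hy v hK
  rw [← hι] at h
  exact (torsionH1OfDvd_mem_selmerLocalKer_iff (W.quadraticTwist c) (v.adicCompletion ℚ) hdn yd).mpr h

/-- **Member `E`, global, on `Δ(E) < 0`**: `ι_* u_d = 2 • u_n`, `res u_n ∈ Sel^{(n)}(E_K/K) ⟹ u_d ∈ Sel^{(d)}(E/ℚ)` (finite places by
`…_of_K`; the infinite place carries no condition on `Δ < 0`).  With OneBitDescent: the descent `Sel(E_K)^{τ=+} → Sel(E/ℚ)` is EXACT ONE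
LEVEL DOWN. [cite: McCallumLMS1991, §4 Lemma 4.3 and Lemma 4.6] [cite: Kolyvagin1989Izv, §3] -/
theorem mem_selmerGroup_of_torsionH1OfDvd_eq_two_zsmul [W.IsElliptic] (h2 : Module.finrank ℚ K = 2) (hΔ : W.Δ < 0)
    {d n : ℤ} (hdn : d ∣ n) {ud : galH1Torsion W d} {un : galH1Torsion W n} (hι : torsionH1OfDvd W hdn ud = (2 : ℤ) • un)
    (hu : resTorsion W K n un ∈ selmerGroup (W.baseChange K) n) :
    ud ∈ selmerGroup W d := by
  rw [mem_selmerGroup_iff] at hu ⊢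
  refine ⟨fun v ↦ mem_selmerLocalKer_of_torsionH1OfDvd_eq_two_zsmul_of_K W h2 hdn hι rfl v (fun w _ ↦ hu.1 w), fun w ↦ ?_⟩
  exact mem_selmerLocalKer_infinitePlace_of_Δ_neg W w hΔ d _

/-- **Twin member, global, on `Δ(E) < 0`** (`c ≠ 0`): `ι_* y_d = 2 • y_n`, `hPsiKT (res y_n) ∈ Sel^{(n)}(E_K/K) ⟹ y_d ∈ Sel^{(d)}(E^{(c)}/ℚ)`.
[cite: McCallumLMS1991, §4 Lemma 4.3 and Lemma 4.6] [cite: Kolyvagin1989Izv, §3] -/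
theorem mem_selmerGroup_twin_of_torsionH1OfDvd_eq_two_zsmul [W.IsElliptic] (h2 : Module.finrank ℚ K = 2) {θ : K} {c : ℚ}
    (hθ : θ ∉ Set.range (algebraMap ℚ K)) (hc : θ ^ 2 = algebraMap ℚ K c) (hc0 : c ≠ 0) (hΔ : W.Δ < 0)
    {d n : ℤ} (hdn : d ∣ n) {yd : galH1Torsion (W.quadraticTwist c) d} {yn : galH1Torsion (W.quadraticTwist c) n}
    (hι : torsionH1OfDvd (W.quadraticTwist c) hdn yd = (2 : ℤ) • yn)
    (hy : hPsiKT W K hθ hc n (resTorsion (W.quadraticTwist c) K n yn) ∈ selmerGroup (W.baseChange K) n) :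
    yd ∈ selmerGroup (W.quadraticTwist c) d := by
  rw [mem_selmerGroup_iff] at hy
  rw [mem_selmerGroup_iff]
  refine ⟨fun v ↦ mem_selmerLocalKer_twin_of_torsionH1OfDvd_eq_two_zsmul_of_K W h2 hθ hc hdn hι rfl v (fun w _ ↦ hy.1 w),
    fun w ↦ ?_⟩
  exact mem_selmerLocalKer_infinitePlace_quadraticTwist_of_Δ_neg W w hΔ hc0 d _

end Rat

end Summit.BirchSwinnertonDyer.BirchSwinnertonDyer.Theorems.GenusExact.SelmerDescent

end
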